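import Summits.KontsevichZagierPeriods.Zeta5Search.Certificates.RecordRayCentreAsymp
import Summits.KontsevichZagierPeriods.Zeta5Search.Certificates.RayC5Forms
import Summits.KontsevichZagierPeriods.Zeta5Search.Certificates.RayC1CentreAsymp
import HarnessLib

/-!
# ζ(5) search — certificates: asymptotic form of the centre value on the ray RayC5 (`Y ∈ [4n, 4n+1]`)
(cell `pub-zeta5`, P1 g11; port of certifier 2's `Certificates/RecordRayCentreAsymp.lean`, generic lemmas imported)

HONEST FRAMING: systematic search; no irrationality claim unless certified.

OUR work (Summit side). For `B₀ = 51n`, `B = BC5E e n` (`e ≤ 1`), any height `4n ≤ Y ≤ 4n+1` and both centre points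
(`c = 51n/2 + s`, `s ∈ [0, 1/2]`):
  `log(Nm(x₀)/D(x₀)) ≤ −156·n log n + n·Ψ + 92·log(101n) + 40`,   `Ψ = 2Γ₄(51/2) − 2Σ_j Γ₄(τ_j)`,
`τ = (9/2, 13/2, 15/2, 19/2, 21/2, 25/2, 27/2)` (`log_centre_C5_le`); `−156 = 2·51 − 4·Σ_j τ_j`.
-/

noncomputable section

open Finset Real MeasureTheory intervalIntegral Set

namespace Summit.KontsevichZagierPeriods.Zeta5Search.RayC5

open Summit.KontsevichZagierPeriods.Zeta5Search.RecordLine (qsq Dx Nm Dx_pos Nm_pos gl Gant Gam Gant_scale gl_mono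
  gl_neg gl_nonneg Gant_zero Gant_mono Gant_sub_le Gant_mono_Y Gant_le_Gant_add log_centre_le)
open Summit.KontsevichZagierPeriods.Zeta5Search.RayC1 (gl_le_crude_C1)

/-- The reduced window half-widths `τ_j = (51 − 2β_j)/2`. -/
def tauC5 (j : ℕ) : ℝ := (51 - 2 * (βC5 j : ℝ)) / 2

/-- The linear-in-`n` coefficient `Ψ = 2Γ₄(51/2) − 2Σ_j Γ₄(τ_j)`. -/
def PsiC5 : ℝ := 2 * Gam 4 (51 / 2) - 2 * ∑ j ∈ range 7, Gam 4 (tauC5 j)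

/-- `Σ_j τ_j = 129/2`. -/
theorem sum_tauC5 : ∑ j ∈ range 7, tauC5 j = 129 / 2 := by
  simp [sum_range_succ, tauC5, βC5]
  norm_num

set_option maxHeartbeats 1600000 in
/-- **ASYMPTOTIC FORM OF THE CENTRE VALUE (ray RayC5 and partner, heights `4n ≤ Y ≤ 4n+1`).** For `e ≤ 1`, `n ≥ 1`,
`0 ≤ s ≤ 1/2` and `c = 51n/2 + s` (centre points `x₀ = −1 − c`):
`log(Nm(x₀)/D(x₀)) ≤ −156·n·log n + n·Ψ + 92·log(101n) + 40`. -/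
theorem log_centre_C5_le {e n : ℕ} (he : e ≤ 1) (hn : 1 ≤ n) {Y : ℝ} (hY1 : 4 * (n : ℝ) ≤ Y)
    (hY2 : Y ≤ 4 * n + 1) {s : ℝ} (hs0 : 0 ≤ s) (hs1 : s ≤ 1 / 2) :
    Real.log (Nm (51 * n) Y (-1 - (51 * (n : ℝ) / 2 + s)) / Dx (51 * n) (BC5E e n) Y (-1 - (51 * (n : ℝ) / 2 + s)))
      ≤ -156 * n * Real.log n + n * PsiC5 + 92 * Real.log (101 * n) + 40 := by
  have hnR : (1 : ℝ) ≤ n := by exact_mod_cast hn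
  have hn0 : (0 : ℝ) < n := by linarith
  have hYpos : 0 < Y := by linarith
  have hYge1 : 1 ≤ Y := by linarith
  have hY8 : Y ≤ 8 * n := by linarith
  have h7n : (0 : ℝ) < 4 * n := by linarith
  set c : ℝ := 51 * (n : ℝ) / 2 + s with hc
  -- the structural bound
  have hB : ∀ j ∈ range 7, 2 * BC5E e n j + 5 ≤ 51 * n := by
    intro j hj
    have hb := βC5_le j
    unfold BC5E
    split_ifs with h6
    · subst h6
      have h20 : βC5 6 = 12 := by simp [βC5]
      rw [h20]; omega
    · have : βC5 j * n ≤ 21 * n := Nat.mul_le_mul_right _ hb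
      omega
  have hmain := log_centre_le (51 * n) (BC5E e n) hB hYge1 (c := c)
    (by rw [hc]; push_cast; linarith) (by rw [hc]; push_cast; linarith)
  -- the stray logarithms
  have hlog101 : 0 ≤ Real.log (101 * n) := Real.log_nonneg (by linarith)
  have g_half : gl Y (1 / 2) ≤ 2 * Real.log (101 * n) :=
    gl_le_crude_C1 hnR hYpos hY8 (by rw [abs_of_nonneg (by norm_num)]; linarith)
  have g_c : gl Y c ≤ 2 * Real.log (101 * n) :=
    gl_le_crude_C1 hnR hYpos hY8 (by rw [hc, abs_of_nonneg (by positivity)]; linarith)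
  have g_1 : gl Y 1 ≤ 2 * Real.log (101 * n) :=
    gl_le_crude_C1 hnR hYpos hY8 (by rw [abs_of_nonneg (by norm_num)]; linarith)
  have G_1 : Gant Y 1 ≤ 2 * Real.log (101 * n) := by
    have h := Gant_sub_le (Y := Y) (a := 0) (b := 1) (M := 1) hYpos.ne' (by norm_num)
      (fun x hx => by rw [abs_le]; constructor <;> linarith [hx.1, hx.2])
    rw [Gant_zero] at h
    linarith
  have G_1_nonneg : 0 ≤ Gant Y 1 := by rw [← Gant_zero Y]; exact Gant_mono hYge1 (by norm_num)
  have hlog4 : Real.log 4 ≤ 2 := by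
    have := Real.log_le_sub_one_of_pos (show (0:ℝ) < 4 by norm_num)
    have h2 : Real.log 4 = 2 * Real.log 2 := by
      rw [show (4:ℝ) = 2 ^ 2 by norm_num, Real.log_pow]; norm_num
    have := Real.log_two_lt_d9
    linarith
  -- scaling at height 4n
  have hscale : ∀ τ : ℝ, Gant (4 * n) (τ * n) = 2 * τ * n * Real.log n + n * Gam 4 τ := fun τ => by
    have := Gant_scale hn0 (by norm_num : (0:ℝ) < 4) τ
    rw [show (4 : ℝ) * n = 4 * n by ring] at this
    exact this
  -- the two big positive terms
  have hbigY : ∀ t : ℝ, 0 ≤ t → t ≤ 51 * n / 2 + 1 →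
      Gant Y t ≤ n * Gam 4 (51 / 2) + 51 * n * Real.log n + 2 * Real.log (101 * n) + 17 := by
    intro t ht0 ht1
    have h1 := Gant_le_Gant_add h7n hY1 ht0
    have hcorr : t * ((Y ^ 2 - (4 * n) ^ 2) / (4 * n) ^ 2) ≤ 17 := by
      have hnum : Y ^ 2 - (4 * (n : ℝ)) ^ 2 ≤ 8 * n + 1 := by nlinarith
      have hden : (0 : ℝ) < (4 * n) ^ 2 := by positivity
      calc t * ((Y ^ 2 - (4 * n) ^ 2) / (4 * n) ^ 2) ≤ (51 * n / 2 + 1) * ((8 * n + 1) / (4 * n) ^ 2) := by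
            apply mul_le_mul ht1 _ (by apply div_nonneg; nlinarith; positivity) (by positivity)
            exact div_le_div_of_nonneg_right hnum hden.le
        _ ≤ 17 := by
            rw [← sub_nonneg]
            have : (51 * (n : ℝ) / 2 + 1) * ((8 * n + 1) / (4 * n) ^ 2) = (51 * n / 2 + 1) * (8 * n + 1) / (16 * n ^ 2) := by
              ring
            rw [this, sub_nonneg, div_le_iff₀ (by positivity)]
            nlinarith
    have h2 : Gant (4 * n) t ≤ Gant (4 * n) (51 / 2 * n) + 1 * gl (4 * n) (51 * n / 2 + 1) := by
      rcases le_or_gt t (51 / 2 * n) with hle | hgt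
      · have := Gant_mono (Y := 4 * n) (by linarith) hle
        have hg : 0 ≤ gl (4 * n) (51 * n / 2 + 1) := gl_nonneg (by linarith) _
        linarith
      · have := Gant_sub_le (Y := 4 * n) (a := 51 / 2 * n) (b := t) (M := 51 * n / 2 + 1) h7n.ne' hgt.le
          (fun x hx => by rw [abs_of_nonneg (by linarith [hx.1])]; linarith [hx.2])
        have hg : 0 ≤ gl (4 * n) (51 * n / 2 + 1) := gl_nonneg (by linarith) _
        nlinarith
    have h3 : gl (4 * n) (51 * n / 2 + 1) ≤ 2 * Real.log (101 * n) :=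
      gl_le_crude_C1 hnR h7n (by linarith) (by rw [abs_of_nonneg (by positivity)]; linarith)
    have h4 := hscale (51 / 2)
    rw [show (51 / 2 : ℝ) * n = 51 / 2 * n by ring] at h4
    nlinarith
  -- the window terms
  have hwin : ∀ j ∈ range 7, ∀ t : ℝ, tauC5 j * n - 3 / 2 ≤ t →
      n * Gam 4 (tauC5 j) + 2 * tauC5 j * n * Real.log n - 4 * Real.log (101 * n) ≤ Gant Y t := by
    intro j hj t ht
    have hj7 := mem_range.1 hj
    have hβhi : (βC5 j : ℝ) ≤ 21 := by exact_mod_cast βC5_le j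
    have hβlo : (12 : ℝ) ≤ βC5 j := by exact_mod_cast βC5_ge hj7
    have hτ : (9 : ℝ) / 2 ≤ tauC5 j ∧ tauC5 j ≤ 27 / 2 := by
      unfold tauC5; constructor <;> linarith
    have ht0 : 0 ≤ t := by nlinarith
    have h1 : Gant (4 * n) t ≤ Gant Y t := Gant_mono_Y h7n hY1 ht0
    have h2 : Gant (4 * n) (tauC5 j * n) - 3 / 2 * gl (4 * n) (tauC5 j * n) ≤ Gant (4 * n) t := by
      rcases le_or_gt (tauC5 j * n) t with hle | hgt
      · have := Gant_mono (Y := 4 * n) (by linarith) hle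
        have hg : 0 ≤ gl (4 * n) (tauC5 j * n) := gl_nonneg (by linarith) _
        linarith
      · have := Gant_sub_le (Y := 4 * n) (a := t) (b := tauC5 j * n) (M := tauC5 j * n) h7n.ne' hgt.le
          (fun x hx => by rw [abs_of_nonneg (by linarith [hx.1])]; exact hx.2)
        have hg : 0 ≤ gl (4 * n) (tauC5 j * n) := gl_nonneg (by linarith) _
        nlinarith
    have h3 : gl (4 * n) (tauC5 j * n) ≤ 2 * Real.log (101 * n) :=
      gl_le_crude_C1 hnR h7n (by linarith) (by rw [abs_of_nonneg (by nlinarith)]; nlinarith)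
    have h4 := hscale (tauC5 j)
    nlinarith
  -- the window arguments are large enough
  have hargs : ∀ j ∈ range 7, tauC5 j * n - 3 / 2 ≤ c - (BC5E e n j : ℝ) ∧
      tauC5 j * n - 3 / 2 ≤ (51 * n : ℕ) - (BC5E e n j : ℝ) - c := by
    intro j hj
    have hj7 := mem_range.1 hj
    have hBjN : BC5E e n j ≤ βC5 j * n + 1 := by
      unfold BC5E; split_ifs <;> omega
    have hBj : (BC5E e n j : ℝ) ≤ (βC5 j : ℝ) * n + 1 := by exact_mod_cast hBjN
    have hτj : tauC5 j * n = (51 - 2 * (βC5 j : ℝ)) / 2 * n := by unfold tauC5; ring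
    rw [hτj, hc]
    push_cast
    constructor <;> nlinarith
  -- assemble
  have hsum : ∑ j ∈ range 7, (Gant Y (c - BC5E e n j) + Gant Y ((51 * n : ℕ) - BC5E e n j - c) - 2 * Gant Y 1) ≥
      ∑ j ∈ range 7, (2 * (n * Gam 4 (tauC5 j) + 2 * tauC5 j * n * Real.log n) - 12 * Real.log (101 * n)) := by
    apply sum_le_sum
    intro j hj
    obtain ⟨ha1, ha2⟩ := hargs j hj
    have w1 := hwin j hj _ ha1
    have w2 := hwin j hj _ ha2
    linarith
  have hτsum : ∑ j ∈ range 7, (2 * (n * Gam 4 (tauC5 j) + 2 * tauC5 j * n * Real.log n) - 12 * Real.log (101 * n))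
      = 2 * n * (∑ j ∈ range 7, Gam 4 (tauC5 j)) + 258 * n * Real.log n - 84 * Real.log (101 * n) := by
    have e1 : ∀ j ∈ range 7, (2 * (n * Gam 4 (tauC5 j) + 2 * tauC5 j * n * Real.log n) - 12 * Real.log (101 * n))
        = (2 * n) * Gam 4 (tauC5 j) + (4 * n * Real.log n) * tauC5 j - 12 * Real.log (101 * n) := fun j _ => by ring
    rw [sum_congr rfl e1, sum_sub_distrib, sum_add_distrib, ← mul_sum, ← mul_sum, sum_const, card_range, sum_tauC5,
      nsmul_eq_mul]
    push_cast
    ring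
  have hc0 : 0 ≤ c := by rw [hc]; positivity
  have hc1 : c ≤ 51 * n / 2 + 1 := by rw [hc]; linarith
  have hpos1 := hbigY c hc0 hc1
  have hpos2 := hbigY ((51 * n : ℕ) + 1 - c) (by rw [hc]; push_cast; linarith) (by rw [hc]; push_cast; linarith)
  have hΨ : n * PsiC5 = 2 * (n * Gam 4 (51 / 2)) - 2 * n * ∑ j ∈ range 7, Gam 4 (tauC5 j) := by
    unfold PsiC5; ring
  have hlogn : 0 ≤ Real.log n := Real.log_nonneg hnR
  rw [hΨ]
  push_cast at hmain hpos2 hsum ⊢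
  linarith [hsum, hτsum.le, hτsum.ge]

end Summit.KontsevichZagierPeriods.Zeta5Search.RayC5
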